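import Summits.BirchSwinnertonDyer.Rank1Residual.Additive.QuadraticBranchEvenMissingPPart
import Summits.BirchSwinnertonDyer.Rank1Residual.Additive.SignedTwistPlusDualTransport
import HarnessLib

/-!
# Route `QuadraticBranchSignedControl` (rung K8, cell `bsd-potss`), crux `PlusEtaLowerInclusion`
# (stmt-BirchSwinnertonDyer-19601) — tools for the CONVERSE road on the Tamagawa-defect rows:
# (D5⁺)⁻¹ the plus dual transport REVERSED, and B. D. Kim's EXACT rank-`0` formula with the main
# conjecture REMOVED (seat `bsd-potss-ctrl` g4)

WHAT. Two tool theorems for `Theorems/QuadraticBranchSignedControlPlusEtaLowerInclusionOfMissingLowerBound.lean`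
(the converse road «lower half of `BSD_p(W)` in Miller's currency ⟹ (E⁺_η)(V)» on ALL tower-onto
rank-`0` Gss2 rows, including the `p ∣ Tam(W)` defect rows that the Selmer-shape road of seat k8-rung
(`quadraticBranchPlusEtaLowerInclusionAt_of_namedFacts_of_selmerWitness`, p459681) cannot reach):
* §1 **`ConverseControl.exists_strictSignedSelmerDualData_one_of_eta`** — (D5⁺)⁻¹: for `K₀ ∋ θ`,
  `θ² = c`, `C • W^{(c)} = V`, `η` the sign character of `θ`, every `η`-signed PLUS dual datum of `V`
  over `K₀ℚ_∞` at a generator `γ ∈ Gal(ℚ̄/K₀)` (`EtaSignedSelmerDualData V κ K₀ E η γ 1`) IS a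
  Pontryagin-dual datum of `Sel⁺(W/ℚ_∞)` (`StrictSignedSelmerDualData W κ E γ 1`) with the SAME module,
  hence the same finiteness / torsion / characteristic ideal / finite submodules — the cell's (D5⁺)
  `SignedTwist.exists_etaSignedSelmerDualData_one` (ctrl g2) read in the opposite direction, any sign
  under the dictionary (D3) (`exists_strictSignedSelmerDualData_of_map_eq`).
* §2 **`ConverseControl.finite_and_padicValNat_card_selmerGroupPInfty_add_eq_of_charIdeal_eq`** —
  B. D. Kim's formula with the main conjecture REMOVED: `W` globally minimal, `p ≥ 5`, `V` a globally
  minimal model of `W^{(p*)}` good at `p` with `a_p(V) = 0`, `D` a plus dual datum of `W` over `ℚ_∞`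
  with `X` finitely generated torsion, no finite submodule, `Char(X) = (g)`, `g(0) ≠ 0`; then
  `Sel_{p^∞}(W/ℚ)` is finite and **`ord_p #Sel_{p^∞}(W/ℚ) + ord_p(Tam(W)/#W(ℚ)_tors²) = v_p(g(0))`**
  — ctrl g2's exact even control (`EvenControlZero.quadraticBranchEvenExactControlOfPlusMCAt_of_readings`,
  p410961) with its only use of (R1⁺) replaced by the displayed generator `g`. Needs Poitou–Tate
  (`hPT`) for the EQUALITY (the inequality `≤` is MC-free and `hPT`-free in `…EvenControlZero`).

HONEST FRAMING (cell `bsd-potss`, run/shared/lean/pub/bsd-potss/; FULL-BSD rank ≤ 1 programme,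
tranche 1b, HUMAN RULING D-0036/D-0074): TOOL THEOREMS ONLY — no definition, no named Literature
fact, no Summits-side `def … : Prop`, no `sorry`, axioms standard. §1 is UNCONDITIONAL Galois /
Pontryagin bookkeeping; §2 is CONDITIONAL on Poitou–Tate duality for Selmer structures
(`poitouTate_selmerStructure_duality_real ℚ`, hypothesis position). Nothing about (C1_η), Kobayashi's
theorems or `BSD(W, p)` of any pair is claimed; nothing is booked; no label / mark / count moves.
`--supports stmt-BirchSwinnertonDyer-19601`.

References: [Kobayashi2003] Def. 2.1 (p. 5), §3 p. 5, §4 p. 8 (`X⁺(E/K_∞)^η`), Thm. 9.3 with (9.33)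
(pp. 26–27); [GreenbergLNM1716] §1 (p. 60), §3 Lemma 3.3, §4 Thm. 4.1 + Lemma 4.2 (p. 102);
[MilneADT2006] I Thm. 4.10; [BDKim2013] Thm. 1.1 (shape of §2).
-/

set_option autoImplicit false
set_option linter.dupNamespace false

noncomputable section

open scoped Classical

open CongruenceSubgroup Field Function NumberField IsDedekindDomain WeierstrassCurve
open Literature.NumberTheory.EllipticCurves
open Literature.NumberTheory.EllipticCurves.ModularForms
open Literature.NumberTheory.EllipticCurves.Rank1Residual
open Literature.NumberTheory.EllipticCurves.Rank1Residual.Typed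
open Literature.NumberTheory.GaloisRepresentations
open Literature.NumberTheory.GaloisCohomology
open Literature.NumberTheory.EllipticCurves.IwasawaAlgebra
open Literature.NumberTheory.EllipticCurves.IwasawaDual ZpExtension
open Summit.BirchSwinnertonDyer.Rank1Residual.X11b.Levels
open Summit.BirchSwinnertonDyer.Rank1Residual.X11b
open Summit.BirchSwinnertonDyer.Rank1Residual.Additive
open Summit.BirchSwinnertonDyer.Rank1Residual.Additive.SignedTwist
open scoped ContRepresentation
open Summit.BirchSwinnertonDyer.Rank1Residual.AdditivePotMult

namespace Summit.BirchSwinnertonDyer.BirchSwinnertonDyer.Theorems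

namespace ConverseControl

/-! ## §1 The plus dual transport, REVERSED: an `η`-datum of `V` over `K₀ℚ_∞` IS a plus datum of `W` over `ℚ_∞` -/

section Transport

variable (W : WeierstrassCurve ℚ) (K₀ : Type) [Field K₀] [NumberField K₀] {θ : K₀} {c : ℚ}
  (hθ : θ ∉ Set.range (algebraMap ℚ K₀)) (hc : θ ^ 2 = algebraMap ℚ K₀ c)
  (p : ℕ) [Fact p.Prime] (κ : ZpExtension ℚ p)
  {V : WeierstrassCurve ℚ} {C : VariableChange ℚ} (hCV : C • W.quadraticTwist c = V)
  (η : absoluteGaloisGroup ℚ →* ℤˣ)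
  (hη : ∀ σ : absoluteGaloisGroup ℚ, η σ = 1 ↔ σ • rootInClosure K₀ θ = rootInClosure K₀ θ)
  (E : Type) [Field E] [Algebra ℚ E] [(galRange (K := ℚ) K₀).Normal]

include hη in
/-- **(D5⁻¹) the dual transport REVERSED, any sign with a Selmer dictionary**: under the dictionary
(D3) at `ε` (`Θ_∞(Sel^{ε,str}(W/ℚ_∞)) = Sel^ε(V/K₀ℚ_∞)^η`), every `η`-signed dual datum `D'` of `V`
over `K₀ℚ_∞` at a generator `γ ∈ Gal(ℚ̄/K₀)` yields a Pontryagin-dual datum of `Sel^{ε,str}(W/ℚ_∞)`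
at the SAME `γ` with the SAME module — hence the same finiteness, torsion, characteristic ideal and
finite submodules. The inverse of the cell's (D5) `exists_etaSignedSelmerDualData_of_map_eq` (there:
`W`-datum ↦ `η`-datum); here `toDual x = D'.toDual x ∘ Θ_∞`, and `Θ_∞ ∘ conj_γ = η(γ)·conj_γ ∘ Θ_∞`
with `η(γ) = 1`. [cite: Kobayashi2003, Def. 2.1 (p. 5), §3 p. 5, §4 p. 8 (X^±(E/K_∞)^η)]
[cite: GreenbergLNM1716, §1 (p. 60)] -/
theorem exists_strictSignedSelmerDualData_of_map_eq (ε : ℤˣ)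
    (hcop : (galRange (K := ℚ) K₀).index.Coprime p)
    (hD3 : (strictSignedSelmerInfty W κ E ε).map (h1TransportInfty W K₀ hθ hc p κ hCV) =
      towerSignedSelmerInftyEta V κ K₀ E η ε)
    {γ : absoluteGaloisGroup ℚ} (hγK : γ ∈ galRange (K := ℚ) K₀)
    (D' : EtaSignedSelmerDualData V κ K₀ E η γ ε) :
    ∃ D : StrictSignedSelmerDualData W κ E γ ε,
      (Module.Finite (IwasawaAlgebra p) D.X ↔ Module.Finite (IwasawaAlgebra p) D'.X) ∧
      (Module.IsTorsion (IwasawaAlgebra p) D.X ↔ Module.IsTorsion (IwasawaAlgebra p) D'.X) ∧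
      D.charIdeal = D'.charIdeal ∧
      ((∀ M : Submodule (IwasawaAlgebra p) D.X, Finite M → M = ⊥) ↔
        (∀ M : Submodule (IwasawaAlgebra p) D'.X, Finite M → M = ⊥)) := by
  -- the Selmer-level isomorphism `Φ = Θ_∞`
  obtain ⟨Φ, hΦ⟩ : ∃ Φ : strictSignedSelmerInfty W κ E ε ≃+ towerSignedSelmerInftyEta V κ K₀ E η ε,
      ∀ s, ((Φ s : towerSignedSelmerInftyEta V κ K₀ E η ε) : V.subgroupH1 p (towerTopSubgroup κ K₀)) =
        h1TransportInfty W K₀ hθ hc p κ hCV s :=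
    ⟨((strictSignedSelmerInfty W κ E ε).equivMapOfInjective (h1TransportInfty W K₀ hθ hc p κ hCV)
        (h1TransportInfty_injective W K₀ hθ hc p κ hCV hcop)).trans (AddEquiv.addSubgroupCongr hD3),
      fun _ ↦ rfl⟩
  -- Galois bookkeeping: `Φ (conj_γ s) = conj_γ (Φ s)` (`η(γ) = 1` for `γ ∈ Gal(ℚ̄/K₀)`)
  have hηγ : η γ = 1 := (hη γ).mpr (apply_rootInClosure_of_mem K₀ hγK)
  have hconj : ∀ s : strictSignedSelmerInfty W κ E ε,
      Φ ⟨W.conjH1 p κ.kerSubgroup γ s, conjH1_mem_strictSignedSelmerInfty W κ E ε γ s.2⟩ =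
        ⟨V.conjH1 p (towerTopSubgroup κ K₀) γ (Φ s : V.subgroupH1 p (towerTopSubgroup κ K₀)),
          conjH1_mem_towerSignedSelmerInftyEta V κ K₀ E η ε γ (Φ s).2⟩ := by
    intro s
    apply Subtype.ext
    rw [hΦ, h1TransportInfty_conjH1 W K₀ hθ hc p κ hCV η hη γ s, ← hΦ, hηγ, Units.val_one, one_zsmul]
  refine ⟨{ X := D'.X
            addCommGroup := D'.addCommGroup
            module := D'.module
            conj_mem := fun _ hs ↦ conjH1_mem_strictSignedSelmerInfty W κ E ε γ hs
            toDual := AddMonoidHom.mk' (fun x ↦ (D'.toDual x).comp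
                (Φ : strictSignedSelmerInfty W κ E ε →+ towerSignedSelmerInftyEta V κ K₀ E η ε))
              (fun x y ↦ by rw [map_add, AddMonoidHom.add_comp])
            bijective := ?_
            toDual_T_smul := ?_
            toDual_C_smul := ?_ }, Iff.rfl, Iff.rfl, rfl, Iff.rfl⟩
  · constructor
    · intro x y hxy
      apply D'.bijective.1
      ext t
      have h := DFunLike.congr_fun hxy (Φ.symm t)
      change D'.toDual x (Φ (Φ.symm t)) = D'.toDual y (Φ (Φ.symm t)) at h
      rwa [AddEquiv.apply_symm_apply] at h
    · intro φ
      obtain ⟨x, hx⟩ := D'.bijective.2 (φ.comp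
        (Φ.symm : towerSignedSelmerInftyEta V κ K₀ E η ε →+ strictSignedSelmerInfty W κ E ε))
      refine ⟨x, ?_⟩
      ext s
      change D'.toDual x (Φ s) = φ s
      rw [hx, AddMonoidHom.comp_apply, AddMonoidHom.coe_coe, AddEquiv.symm_apply_apply]
  · intro x s
    change D'.toDual (PowerSeries.X • x) (Φ s) =
      D'.toDual x (Φ ⟨W.conjH1 p κ.kerSubgroup γ s, _⟩) - D'.toDual x (Φ s)
    rw [D'.toDual_T_smul x _, hconj]
  · intro c' x s k hk
    change D'.toDual (PowerSeries.C c' • x) (Φ s) = (PadicInt.toZModPow k c').val • D'.toDual x (Φ s)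
    exact D'.toDual_C_smul c' x _ k (by rw [← map_nsmul, hk, map_zero])

include hθ hc hCV hη in
/-- **(D5⁺⁻¹) THE PLUS DUAL TRANSPORT REVERSED: `X⁺(V/K₀ℚ_∞)^η` IS `X⁺_W(ℚ_∞)`** — every `η`-signed PLUS
dual datum `D'` of `V` over `K₀ℚ_∞` at a generator `γ ∈ Gal(ℚ̄/K₀)` yields a Pontryagin-dual datum of
`Sel⁺(W/ℚ_∞)` (`StrictSignedSelmerDualData W κ E γ 1`) with the same module, finiteness, torsion,
characteristic ideal and finite submodules; the dictionary (D3⁺)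
`map_h1TransportInfty_strictSignedSelmerInfty_one` discharges the hypothesis of the any-sign version.
[cite: Kobayashi2003, Def. 2.1 (p. 5), §3 p. 5, §4 p. 8 (X⁺(E/K_∞)^η)] [cite: GreenbergLNM1716, §1 (p. 60)] -/
theorem exists_strictSignedSelmerDualData_one_of_eta
    (hD : ∀ g : absoluteGaloisGroup ℚ, ∃ τ : absoluteGaloisGroup E,
      (resGalOfEmb (closureEmb (K := ℚ) E) τ)⁻¹ * g ∈ towerTopSubgroup κ K₀)
    (hκ₀ : ∀ x, ∃ g ∈ galRange (K := ℚ) K₀, κ g = x)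
    (hcop : (galRange (K := ℚ) K₀).index.Coprime p)
    {γ : absoluteGaloisGroup ℚ} (hγK : γ ∈ galRange (K := ℚ) K₀)
    (D' : EtaSignedSelmerDualData V κ K₀ E η γ 1) :
    ∃ D : StrictSignedSelmerDualData W κ E γ 1,
      (Module.Finite (IwasawaAlgebra p) D.X ↔ Module.Finite (IwasawaAlgebra p) D'.X) ∧
      (Module.IsTorsion (IwasawaAlgebra p) D.X ↔ Module.IsTorsion (IwasawaAlgebra p) D'.X) ∧
      D.charIdeal = D'.charIdeal ∧
      ((∀ M : Submodule (IwasawaAlgebra p) D.X, Finite M → M = ⊥) ↔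
        (∀ M : Submodule (IwasawaAlgebra p) D'.X, Finite M → M = ⊥)) :=
  exists_strictSignedSelmerDualData_of_map_eq W K₀ hθ hc p κ hCV η hη E 1 hcop
    (map_h1TransportInfty_strictSignedSelmerInfty_one W K₀ hθ hc p κ hCV E η hη hD hκ₀ hcop) hγK D'

end Transport

/-! ## §2 Exact even control WITHOUT the main conjecture: B. D. Kim's formula at `η` for ANY generator -/

section Control

variable (W : WeierstrassCurve ℚ) [W.IsElliptic] [W.IsGloballyMinimal] (p : ℕ) [hp : Fact p.Prime]

/-- **B. D. Kim's formula at `η` for ANY characteristic power series — exact even control with the main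
conjecture REMOVED.** For `W` globally minimal, `p ≥ 5`, `V` a globally minimal model of `W^{(p*)}`
good at `p` with `a_p(V) = 0`, a cyclotomic `κ` with topological generator `γ`, and a Pontryagin-dual
datum `D` of `Sel⁺(W/ℚ_∞)` with `X` finitely generated torsion, NO non-trivial finite `Λ`-submodule,
`Char(X) = (g)` and `g(0) ≠ 0`: **`Sel_{p^∞}(W/ℚ)` is finite and
`ord_p #Sel_{p^∞}(W/ℚ) + ord_p(Tam(W)/#W(ℚ)_tors²) = v_p(g(0))`**. The cell's R-ctrl-17 theorem
`EvenControlZero.quadraticBranchEvenExactControlOfPlusMCAt_of_readings` (ctrl g2, p407740) with its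
only use of (R1⁺) — "`Char(X) = (L_p⁺(V,η,X))`" — replaced by the displayed generator `g`: file 1
(`#A₀⁺ = p^{v_p g(0)}`, Greenberg Lemma 4.2 + Kobayashi (9.33)), §1 of the discharge file
(`#A₀⁺ = #Sel · ∏_T p^{ord_p c_ℓ}`, Poitou–Tate `hPT`), `∑_T ord_p c_ℓ = ord_p Tam(W)` (`c_p(W) ≤ 4 < p`),
`p ∤ #W(ℚ)_tors`. CONDITIONAL on `hPT` only; nothing booked.
[cite: Kobayashi2003, Thm. 9.3 with (9.33) (pp. 26–27)] [cite: GreenbergLNM1716, §3 Lemma 3.3, §4 Thm. 4.1 and Lemma 4.2 (p. 102)]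
[cite: MilneADT2006, Ch. I, Thm. 4.10] [cite: BDKim2013, Thm. 1.1 (shape)] -/
theorem finite_and_padicValNat_card_selmerGroupPInfty_add_eq_of_charIdeal_eq
    (hPT : poitouTate_selmerStructure_duality_real ℚ)
    (V : WeierstrassCurve ℚ) [V.IsElliptic] [V.IsGloballyMinimal] (C : VariableChange ℚ)
    (hp5 : 5 ≤ p) (hCV : C • W.quadraticTwist ((-1) ^ (p / 2) * p) = V)
    (hgood : V.HasGoodReductionAtPrime p) (hap : V.frobeniusTrace p = 0)
    {κ : ZpExtension ℚ p} {γ : absoluteGaloisGroup ℚ} (hκ : κ.IsCyclotomic)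
    (hγ : κ.IsTopGenerator γ) (D : StrictSignedSelmerDualData W κ ℚ_[p] γ 1)
    [Module.Finite (IwasawaAlgebra p) D.X] (htor : Module.IsTorsion (IwasawaAlgebra p) D.X)
    (hnf : ∀ N : Submodule (IwasawaAlgebra p) D.X, Finite N → N = ⊥)
    {g : IwasawaAlgebra p} (hchar : D.charIdeal = Ideal.span {g})
    (h0 : PowerSeries.constantCoeff g ≠ 0) :
    Finite ↥(W.selmerGroupPInfty p) ∧
      (padicValNat p (Nat.card ↥(W.selmerGroupPInfty p)) : ℤ) +
          padicValRat p ((W.tamagawaProduct : ℚ) / (W.torsionOrder : ℚ) ^ 2) =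
        ((PowerSeries.constantCoeff g : ℤ_[p]) : ℚ_[p]).valuation := by
  have hp2 : p ≠ 2 := by omega
  set v₀ := (Rat.HeightOneSpectrum.primesEquiv (R := 𝓞 ℚ)).symm ⟨p, hp.out⟩ with hv₀
  -- file 1: `Sel` finite and `#A₀⁺ = p^{v_p g(0)}`
  obtain ⟨hfinSel, -, -, hA⟩ :=
    EvenControlZero.finite_and_padicValNat_card_selmerGroupPInfty_add_eq_of_quadraticTwist_signedPrime W
      κ hp2 C V hCV hgood hap hγ D htor hnf hchar h0
  haveI hfinA : Finite (↥((W.selmerInfty κ ⊓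
      ⨅ σ : Field.absoluteGaloisGroup ℚ,
        (Kobayashi2003.localKummerOverOfEmb W p κ.kerSubgroup (closureEmb (K := ℚ) ℚ_[p])
            (⨆ m, strictSignedLocalPoints κ ℚ_[p] W 1 m)).comap
          (W.conjH1 p κ.kerSubgroup σ)).comap
      (W.layerToInfty κ 0))) :=
    Nat.finite_of_card_ne_zero (by rw [hA]; exact pow_ne_zero _ hp.out.ne_zero)
  -- the exceptional set `T` = the bad places `≠ v₀`
  obtain ⟨S, hS⟩ := exists_finset_forall_not_mem_good W p
  set T := S.filter (fun v ↦ (p : 𝓞 ℚ) ∉ v.asIdeal) with hT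
  have hv₀p : (p : 𝓞 ℚ) ∈ v₀.asIdeal := (natCast_mem_asIdeal_iff_eq_primesEquiv_symm v₀ hp.out).mpr rfl
  have hpT : v₀ ∉ T := fun h ↦ (Finset.mem_filter.mp h).2 hv₀p
  have hTmem : ∀ v : HeightOneSpectrum (𝓞 ℚ), v ≠ v₀ →
      p ∣ (W.baseChange (v.adicCompletion ℚ)).localTamagawaNumber (v.adicCompletionIntegers ℚ) → v ∈ T := by
    intro v hv hdvd
    refine Finset.mem_filter.mpr ⟨?_, fun hpv ↦ hv ((natCast_mem_asIdeal_iff_eq_primesEquiv_symm v hp.out).mp hpv)⟩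
    by_contra hvS
    rw [W.localTamagawaNumber_eq_one_of_hasGoodReductionAt_holds v (hS v hvS).2] at hdvd
    exact hp.out.one_lt.ne' (Nat.dvd_one.mp hdvd)
  -- §1 of the discharge file
  have hcard := RankZeroCount.card_localPreimage_one_eq_card_selmer_mul_prod_of_quadraticTwist_signedPrime
    κ W hp2 hκ C V hCV hgood hap hPT T hpT hTmem
  -- bookkeeping
  have hc0 := LevelBridge.padicValNat_localTamagawaNumber_eq_zero_of_quadraticTwist_signedPrime W p hp5 C V
    hCV hgood
  have hTamSum := LevelBridge.sum_padicValNat_localTamagawaNumber_eq_padicValNat_tamagawaProduct W p T hpT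
    hTmem hc0
  have htors := eq_zero_of_prime_smul_eq_zero_padic_of_quadraticTwist_goodSupersingular hp2 W C V hCV hgood hap
  have htors0 := LevelBridge.padicValNat_torsionOrder_eq_zero_of_noPTorsion W p htors
  have hTamQ : (W.tamagawaProduct : ℚ) ≠ 0 := by exact_mod_cast W.tamagawaProduct_pos_holds.ne'
  have htQ : (W.torsionOrder : ℚ) ≠ 0 := by exact_mod_cast W.torsionOrder_pos_holds.ne'
  have hrat : padicValRat p ((W.tamagawaProduct : ℚ) / (W.torsionOrder : ℚ) ^ 2) =
      (padicValNat p W.tamagawaProduct : ℤ) := by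
    rw [padicValRat.div hTamQ (pow_ne_zero 2 htQ), padicValRat.pow, padicValRat.of_nat, padicValRat.of_nat,
      htors0]
    simp
  refine ⟨hfinSel, ?_⟩
  -- numerics: `a = ord #Sel + ∑_T ord c_ℓ` from `p^a = #Sel · ∏ p^{ord c_ℓ}`
  haveI := hfinSel
  have hSel0 : Nat.card ↥(W.selmerGroupPInfty p) ≠ 0 := Nat.card_pos.ne'
  have hp0 : p ≠ 0 := hp.out.ne_zero
  rw [hA, Finset.prod_pow_eq_pow_sum, hTamSum] at hcard
  have hval := congrArg (padicValNat p) hcard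
  rw [padicValNat.prime_pow, padicValNat.mul hSel0 (pow_ne_zero _ hp0), padicValNat.prime_pow] at hval
  have hv' : ((PowerSeries.constantCoeff g : ℤ_[p]) : ℚ_[p]).valuation =
      ((((PowerSeries.constantCoeff g : ℤ_[p]) : ℚ_[p]).valuation).toNat : ℤ) :=
    (Int.toNat_of_nonneg (PadicInt.valuation_coe_nonneg)).symm
  rw [hrat, hv', hval]
  push_cast
  ring

end Control

end ConverseControl

end Summit.BirchSwinnertonDyer.BirchSwinnertonDyer.Theorems

end
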